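import Summits.BirchSwinnertonDyer.Rank1Residual.GaloisImage.PrimeToPFixingLevel
import Literature.NumberTheory.NumberFields.IrreducibleBinomialOfEveryDegree
import Mathlib.FieldTheory.Galois.Infinite
import Mathlib.FieldTheory.SplittingField.IsSplittingField
import Mathlib.FieldTheory.Normal.Basic
import Mathlib.FieldTheory.Relrank
import Mathlib.FieldTheory.IsAlgClosed.Basic
import HarnessLib

/-!
# A prime-to-`3` NORMAL level of `Γ_ℚ` fixing a quartic Kummer generator `θ`, `θ⁴ = 3` — row
# T-CG-SS addendum A3, file A3b (cell `b2b-bsdres`, team n1011; seat n1011-p05 gen 8)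

HONEST FRAMING (cell `b2b-bsdres`, run/shared/lean/b2b/bsd-rank1-residual/, verbatim in every
file): the goal of the cell is to DELETE the COMBINATION-SHAPED residual classes of the
Birch–Swinnerton-Dyer formula for ALL analytic-rank `≤ 1` elliptic curves over `ℚ` — "full BSD
formula for every rank `≤ 1` curve in class `C`" assembled STRICTLY from published theorems — so
that the rank-`≤ 1` remainder becomes exactly the CONSTRUCTION-SHAPED classes, which are TYPED
(missing-input `Prop`s), NOT attempted. This is not "finishing BSD". Team n1011 (X4 ∧ `p = 3`,
§I N10/N11; here in the service of the O5 cell `(t′)@3`): research route; TOOL theorems of Galois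
theory, ALL UNCONDITIONAL; no definition, no named fact; nothing booked; no label changes.

## What (and why)

Schneider's theorem (Greenberg LNM 1716 Thm. 1.7) on the census cell `(t′)` at `p = 3` (Kodaira
`III/III*`, tame, semistability defect `e = 4`) descends the vacuous local condition from the layer
`ℚ_∞ · L` to `ℚ_∞` along an open NORMAL subgroup `U ≤ Γ_ℚ` of index PRIME TO `3` whose local elements
fix the Kummer generator `θ`, `θ⁴ = 3`, of the good model (file A3a). K1's levels
(`PrimeToPFixingLevel`: index `∣ (deg θ)! = 24`, or the pair trick of A2b, degrees `< p`) do not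
reach `p = 3`. Here the level is the GALOIS CLOSURE: `F = ℚ(rootSet(X⁴ − 3)) ⊂ ℚ̄` is the splitting
field of `X⁴ − 3` (Mathlib `IntermediateField.adjoin_rootSet_isSplittingField`), hence normal, so
`U = Fix(F)` is an open normal subgroup (`InfiniteGalois.normal_iff_isGalois`) of index `[F : ℚ]`
(`IntermediateField.finrank_eq_fixingSubgroup_index`); and `[F : ℚ] ∣ [ℚ(θ, i) : ℚ] = 4 · [ℚ(θ)(i) : ℚ(θ)]
∈ {4, 8}` (`F ⊆ ℚ(θ, i)` since every root is `ζθ` with `ζ⁴ = 1`, `ζ ∈ {±1, ±i}`; `[ℚ(θ) : ℚ] = 4` by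
Eisenstein at `3` — the tree's `irreducible_X_pow_sub_C_of_mem_of_not_mem_sq` + Gauss's lemma), so
`3 ∤ [Γ_ℚ : U]`:

* `irreducible_X_pow_four_sub_three` — `X⁴ − 3` is irreducible over `ℚ`;
* `finrank_adjoin_eq_four_of_pow_four_eq_three` — `[ℚ(θ) : ℚ] = 4`;
* **`exists_normal_isOpen_coprime_three_smul_eq_of_pow_four_eq_three`** — the level, in the shape
  of K1's `exists_normal_isOpen_coprime_smul_eq` (so that K1 §3's local form
  `smul_absClosureEmbedding_eq_of_absGaloisRestrict_mem` applies verbatim).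

References: J. Neukirch, *Algebraic Number Theory*, IV §1 [NeukirchANT1999]; S. Lang, *Algebra*,
IV §3 (Eisenstein) and VI §1 (splitting fields, normal extensions); cells/n1011/skel/T-CG-SS-A3.md
(4ee65abe034abfbf).
-/

noncomputable section

open scoped Classical IntermediateField Polynomial

open Polynomial

namespace Summit.BirchSwinnertonDyer.Rank1Residual.GaloisImage

open Field Literature.NumberTheory.GaloisRepresentations

/-! ## §1 `X⁴ − 3` is irreducible over `ℚ`; `[ℚ(θ) : ℚ] = 4` -/

/-- `X⁴ − 3 ∈ ℚ[X]` is irreducible (Eisenstein at `3` over `ℤ`, Gauss's lemma). [folklore] -/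
theorem irreducible_X_pow_four_sub_three : Irreducible (X ^ 4 - C (3 : ℚ) : ℚ[X]) := by
  have hZ : Irreducible (X ^ 4 - C (3 : ℤ) : ℤ[X]) := by
    have hP : (Ideal.span {(3 : ℤ)}).IsPrime :=
      (Ideal.span_singleton_prime (by norm_num)).mpr Int.prime_three
    refine Literature.NumberTheory.NumberFields.irreducible_X_pow_sub_C_of_mem_of_not_mem_sq hP
      (Ideal.mem_span_singleton_self _) ?_ (by norm_num)
    rw [Ideal.span_singleton_pow, Ideal.mem_span_singleton]
    norm_num
  have hmon : (X ^ 4 - C (3 : ℤ) : ℤ[X]).Monic := monic_X_pow_sub_C _ (by norm_num)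
  have h := (hmon.irreducible_iff_irreducible_map_fraction_map (K := ℚ)).mp hZ
  have hmap : (X ^ 4 - C (3 : ℤ) : ℤ[X]).map (algebraMap ℤ ℚ) = X ^ 4 - C (3 : ℚ) := by
    rw [Polynomial.map_sub, Polynomial.map_pow, map_X, map_C, map_ofNat]
  rwa [hmap] at h

/-- For `θ ∈ ℚ̄` with `θ⁴ = 3`: `minpoly_ℚ θ = X⁴ − 3` and `[ℚ(θ) : ℚ] = 4`. [folklore] -/
theorem finrank_adjoin_eq_four_of_pow_four_eq_three {θ : AlgebraicClosure ℚ} (hθ : θ ^ 4 = 3) :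
    Module.finrank ℚ ℚ⟮θ⟯ = 4 := by
  haveI : Algebra.IsAlgebraic ℚ (AlgebraicClosure ℚ) := AlgebraicClosure.isAlgebraic ℚ
  have hint : IsIntegral ℚ θ := (Algebra.IsAlgebraic.isAlgebraic θ).isIntegral
  have hmin : (X ^ 4 - C (3 : ℚ) : ℚ[X]) = minpoly ℚ θ :=
    minpoly.eq_of_irreducible_of_monic irreducible_X_pow_four_sub_three
      (by simp only [map_sub, map_pow, aeval_X, map_ofNat, hθ, sub_self])
      (monic_X_pow_sub_C _ (by norm_num))
  rw [IntermediateField.adjoin.finrank hint, ← hmin, natDegree_X_pow_sub_C]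

/-! ## §2 The Galois closure `ℚ(θ, i)` and the level -/

/-- Every fourth root of `3` in `ℚ̄` is `ζ θ` with `ζ ∈ {1, −1, i, −i}`, hence lies in `ℚ(θ, i)`.
[folklore] -/
theorem mem_adjoin_pair_of_pow_four_eq_three {θ i r : AlgebraicClosure ℚ} (hθ : θ ^ 4 = 3)
    (hi : i ^ 2 = -1) (hr : r ^ 4 = 3) : r ∈ ℚ⟮θ, i⟯ := by
  have hθ0 : θ ≠ 0 := by
    rintro rfl; norm_num at hθ
  have hθmem : θ ∈ ℚ⟮θ, i⟯ := IntermediateField.subset_adjoin _ _ (Set.mem_insert _ _)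
  have himem : i ∈ ℚ⟮θ, i⟯ := IntermediateField.subset_adjoin _ _ (Set.mem_insert_of_mem _ rfl)
  set ζ := r / θ with hζ
  have hr' : r = ζ * θ := by rw [hζ, div_mul_cancel₀ r hθ0]
  have hζ4 : ζ ^ 4 = 1 := by
    rw [hζ, div_pow, hr, hθ]; norm_num
  have hprod : (ζ - 1) * (ζ + 1) * (ζ - i) * (ζ + i) = 0 := by
    have : (ζ - 1) * (ζ + 1) * (ζ - i) * (ζ + i) = ζ ^ 4 - (i ^ 2 + 1) * ζ ^ 2 + i ^ 2 := by ring
    rw [this, hζ4, hi]; ring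
  rcases mul_eq_zero.mp hprod with h | h
  · rcases mul_eq_zero.mp h with h | h
    · rcases mul_eq_zero.mp h with h | h
      · rw [hr', sub_eq_zero.mp h, one_mul]; exact hθmem
      · rw [hr', eq_neg_of_add_eq_zero_left h, neg_mul, one_mul]; exact neg_mem hθmem
    · rw [hr', sub_eq_zero.mp h]; exact mul_mem himem hθmem
  · rw [hr', eq_neg_of_add_eq_zero_left h, neg_mul]; exact neg_mem (mul_mem himem hθmem)

/-- `[ℚ(θ, i) : ℚ] ∈ {4, 8}` for `θ⁴ = 3`, `i² = −1`: the tower `ℚ ⊂ ℚ(θ) ⊂ ℚ(θ)(i)` with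
`[ℚ(θ) : ℚ] = 4` and `[ℚ(θ)(i) : ℚ(θ)] ≤ 2`. [folklore] -/
theorem finrank_adjoin_pair_of_pow_four_eq_three {θ i : AlgebraicClosure ℚ} (hθ : θ ^ 4 = 3)
    (hi : i ^ 2 = -1) :
    Module.finrank ℚ ℚ⟮θ, i⟯ = 4 ∨ Module.finrank ℚ ℚ⟮θ, i⟯ = 8 := by
  haveI : Algebra.IsAlgebraic ℚ (AlgebraicClosure ℚ) := AlgebraicClosure.isAlgebraic ℚ
  have hiint : IsIntegral ℚ⟮θ⟯ i :=
    ((Algebra.IsAlgebraic.isAlgebraic (R := ℚ) i).isIntegral).tower_top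
  haveI : FiniteDimensional ℚ⟮θ⟯ ℚ⟮θ⟯⟮i⟯ := IntermediateField.adjoin.finiteDimensional hiint
  -- `[ℚ(θ)(i) : ℚ(θ)] ≤ 2`
  have hfin : Module.finrank ℚ⟮θ⟯ ℚ⟮θ⟯⟮i⟯ = (minpoly ℚ⟮θ⟯ i).natDegree :=
    IntermediateField.adjoin.finrank hiint
  have hpos : 0 < Module.finrank ℚ⟮θ⟯ ℚ⟮θ⟯⟮i⟯ := by
    rw [hfin]; exact minpoly.natDegree_pos hiint
  have hle2 : Module.finrank ℚ⟮θ⟯ ℚ⟮θ⟯⟮i⟯ ≤ 2 := by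
    rw [hfin]
    have hne : (X ^ 2 + C (1 : ℚ⟮θ⟯) : ℚ⟮θ⟯[X]) ≠ 0 := by
      apply Monic.ne_zero
      exact monic_X_pow_add_C _ (by norm_num)
    have hroot : aeval i (X ^ 2 + C (1 : ℚ⟮θ⟯) : ℚ⟮θ⟯[X]) = 0 := by
      simp only [map_add, map_pow, aeval_X, map_one, hi]; norm_num
    calc (minpoly ℚ⟮θ⟯ i).natDegree ≤ (X ^ 2 + C (1 : ℚ⟮θ⟯) : ℚ⟮θ⟯[X]).natDegree :=
          natDegree_le_natDegree (minpoly.degree_le_of_ne_zero ℚ⟮θ⟯ i hne hroot)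
      _ = 2 := natDegree_X_pow_add_C
  -- tower
  have h1 : Module.finrank ℚ (ℚ⟮θ⟯⟮i⟯.restrictScalars ℚ) = Module.finrank ℚ ℚ⟮θ⟯⟮i⟯ := rfl
  have h2 : ℚ⟮θ⟯⟮i⟯.restrictScalars ℚ = ℚ⟮θ, i⟯ := IntermediateField.adjoin_simple_adjoin_simple ℚ θ i
  have htower : Module.finrank ℚ ℚ⟮θ, i⟯ = Module.finrank ℚ ℚ⟮θ⟯ * Module.finrank ℚ⟮θ⟯ ℚ⟮θ⟯⟮i⟯ := by
    rw [← h2, h1, Module.finrank_mul_finrank]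
  rw [htower, finrank_adjoin_eq_four_of_pow_four_eq_three hθ]
  interval_cases (Module.finrank ℚ⟮θ⟯ ℚ⟮θ⟯⟮i⟯) <;> simp

/-- **An open NORMAL subgroup of `Γ_ℚ` of index PRIME TO `3` fixing a quartic Kummer generator**
`θ ∈ ℚ̄`, `θ⁴ = 3`: the fixing group of the splitting field `F = ℚ(rootSet(X⁴ − 3)) ⊆ ℚ(θ, i)`,
normal (Mathlib `Normal.of_isSplittingField`, `InfiniteGalois.normal_iff_isGalois`), open, of index
`[F : ℚ] ∣ [ℚ(θ, i) : ℚ] ∈ {4, 8}`. The shape is that of K1's `exists_normal_isOpen_coprime_smul_eq`.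
[cite: NeukirchANT1999, Ch. IV §1] -/
theorem exists_normal_isOpen_coprime_three_smul_eq_of_pow_four_eq_three {θ : AlgebraicClosure ℚ}
    (hθ : θ ^ 4 = 3) :
    ∃ U : Subgroup (absoluteGaloisGroup ℚ), U.Normal ∧ IsOpen (U : Set (absoluteGaloisGroup ℚ)) ∧
      U.index.Coprime 3 ∧ ∀ σ ∈ U, σ • θ = θ := by
  haveI : IsGalois ℚ (AlgebraicClosure ℚ) :=
    @IsAlgClosure.isGalois ℚ (AlgebraicClosure ℚ) _ _ (AlgebraicClosure.instAlgebra ℚ) inferInstance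
      inferInstance
  haveI : Algebra.IsAlgebraic ℚ (AlgebraicClosure ℚ) := AlgebraicClosure.isAlgebraic ℚ
  set f : ℚ[X] := X ^ 4 - C (3 : ℚ) with hf
  have hf0 : f ≠ 0 := (monic_X_pow_sub_C (3 : ℚ) (by norm_num)).ne_zero
  set F : IntermediateField ℚ (AlgebraicClosure ℚ) := IntermediateField.adjoin ℚ (f.rootSet _) with hF
  -- `F` is the splitting field of `f`: normal, Galois, finite
  haveI hsplit : f.IsSplittingField ℚ F :=
    IntermediateField.adjoin_rootSet_isSplittingField (IsAlgClosed.splits _)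
  haveI : Normal ℚ F := Normal.of_isSplittingField f
  haveI : FiniteDimensional ℚ F :=
    IntermediateField.finiteDimensional_adjoin fun x hx ↦
      (isAlgebraic_of_mem_rootSet hx).isIntegral
  haveI : Algebra.IsSeparable ℚ F :=
    Algebra.isSeparable_tower_bot_of_isSeparable ℚ F (AlgebraicClosure ℚ)
  haveI hFG : IsGalois ℚ F := isGalois_iff.mpr ⟨inferInstance, inferInstance⟩
  -- roots: `θ ∈ F`, and every root lies in `ℚ(θ, i)`
  have hmem_rootSet : ∀ {r : AlgebraicClosure ℚ}, r ^ 4 = 3 → r ∈ f.rootSet (AlgebraicClosure ℚ) := by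
    intro r hr
    rw [mem_rootSet']
    refine ⟨Polynomial.map_ne_zero hf0, ?_⟩
    simp only [hf, map_sub, map_pow, aeval_X, map_ofNat, hr, sub_self]
  have hθF : θ ∈ F := IntermediateField.subset_adjoin _ _ (hmem_rootSet hθ)
  obtain ⟨i, hi⟩ : ∃ i : AlgebraicClosure ℚ, i ^ 2 = -1 := IsAlgClosed.exists_pow_nat_eq _ two_pos
  have hFle : F ≤ ℚ⟮θ, i⟯ := by
    rw [hF, IntermediateField.adjoin_le_iff]
    intro r hr
    rw [mem_rootSet'] at hr
    have hr4 : r ^ 4 = 3 := by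
      have h := hr.2
      simp only [hf, map_sub, map_pow, aeval_X, map_ofNat] at h
      exact sub_eq_zero.mp h
    exact mem_adjoin_pair_of_pow_four_eq_three hθ hi hr4
  -- the level `U = Fix(F)`, read in `Γ_ℚ`
  set U : Subgroup (absoluteGaloisGroup ℚ) := F.fixingSubgroup with hU
  have hUn : U.Normal := (InfiniteGalois.normal_iff_isGalois F).mpr hFG
  have hUo : IsOpen (U : Set (absoluteGaloisGroup ℚ)) := F.fixingSubgroup_isOpen
  have hidx : U.index = Module.finrank ℚ F := (IntermediateField.finrank_eq_fixingSubgroup_index F).symm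
  refine ⟨U, hUn, hUo, ?_, fun σ hσ ↦ ?_⟩
  · -- index `[F : ℚ]` divides `[ℚ(θ, i) : ℚ] ∈ {4, 8}`
    rw [hidx]
    have hdvd : Module.finrank ℚ F ∣ Module.finrank ℚ ℚ⟮θ, i⟯ :=
      Dvd.intro _ (IntermediateField.finrank_bot_mul_relfinrank hFle)
    refine ((Nat.Prime.coprime_iff_not_dvd Nat.prime_three).mpr ?_).symm
    intro h3
    have h3' := dvd_trans h3 hdvd
    rcases finrank_adjoin_pair_of_pow_four_eq_three hθ hi with h | h <;> rw [h] at h3' <;> omega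
  · have hσ' : σ ∈ F.fixingSubgroup := hσ
    exact (IntermediateField.mem_fixingSubgroup_iff F σ).mp hσ' θ hθF

end Summit.BirchSwinnertonDyer.Rank1Residual.GaloisImage

end
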